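import Summits.BirchSwinnertonDyer.BirchSwinnertonDyer.Theses.KatoDescentPotSupersingular
import Summits.BirchSwinnertonDyer.BirchSwinnertonDyer.Theses.KatoDescentTamePotSupersingular
import Summits.BirchSwinnertonDyer.BirchSwinnertonDyer.Theorems.KatoDescentPotSupersingularMemberHullZetaCoreInputsOfKummer
import Summits.BirchSwinnertonDyer.BirchSwinnertonDyer.Theorems.KatoDescentPotSupersingularReducibleKatoMemberZetaInputsDescent
import Summits.BirchSwinnertonDyer.BirchSwinnertonDyer.Theorems.PoitouTateSelmerStructureDualityConjHolds
import HarnessLib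

/-!
# Crux M `ReducibleKatoMember` (item stmt-BirchSwinnertonDyer-19196, routes `KatoDescentPotSupersingular` (K9) and
# `KatoDescentTamePotSupersingular` (K8-t′), cell `bsd-potss`): the Poitou–Tate hypothesis is DISCHARGED —
# M follows in the kernel from modularity, Gross–Zagier–Kolyvagin and Kato's CORE member package ALONE
# (typed closers over the LIVE route names; route-free compositions; Kummer-form variants)

`--supports stmt-BirchSwinnertonDyer-19196 --as helper`.  THEOREMS ONLY (no definition, no named fact, no `sorry`).
Seat `bsd-potss-rkm` g23.

WHY.  Item 27963 `HeldPoitouTateSelmerDualityQ` (the Poitou–Tate child of M's gen-4/gen-5 split) was CLOSED today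
(p641385): `poitouTate_selmerStructure_duality ℚ` is a theorem of the tree
(`InputsPoitouTateSelmer.poitouTate_selmerStructure_duality_conj_holds ℚ` + the Literature bridge
`poitouTate_selmerStructure_duality_of_conj`).  Every typed closer of M landed so far (seat rkm g21/g22:
`reducibleKatoMember_of_newformZ_of_coreInputs`, `…_of_kummerCoreInputs`, the glue closers of 27964 / 28004) carries that
fact as a HYPOTHESIS.  This file removes it, so that the reading of record becomes, in the kernel:

  **M ⟸ { modularity `exists_isNewformOf`, Gross–Zagier–Kolyvagin `rank_eq_analyticRank_of_analyticRank_le_one`,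
          Kato's core member package `Kato2004.exists_memberHullZetaCoreInputs` (HELD child 27962) }**,

and likewise with the PRINT-EXACT Kummer-form package `Kato2004.exists_memberHullZetaKummerCoreInputs` (p637289) in place of
the core package (kernel bridge `exists_memberHullZetaCoreInputs_of_kummerCoreInputs`, p638165).

WHAT.
* §1 `poitouTate_selmerStructure_duality_rat` — the fact at `ℚ`, as a theorem (abbreviation of the two tree theorems).
* §2 route-free: `exists_memberHullZetaInputs_of_gzk_of_coreInputs` (the retired gen-3 package 20297 from 27962 + GZK, no PT),
  `…_of_gzk_of_kummerCoreInputs`; `katoMemberShaBoundOfReducible_of_newform_of_gzk_of_coreInputs` (the O6 node behind M from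
  the three inputs), `…_of_kummerCoreInputs`.
* §3 typed closers over the LIVE route declarations only (no retired alias is named, so no later re-render can redden them):
  K9 `wildReducibleKatoMember_of_modularityGZK_of_coreInputs : PublishedInputsModularityGZK → PublishedInputMemberHullZetaCore →
  ReducibleKatoMember` (items 28002, 27962 ⟹ 19196); K8-t′ `tameReducibleKatoMember_of_newformZ_of_coreInputs_of_rankZ :
  PublishedInputNewformKatoZ → PublishedInputMemberHullZetaCore → PublishedInputRankEqAnalyticRankZ → ReducibleKatoMember`
  (items 20296, 27962, 20298 ⟹ 19196).  These are the glue terms of a future 2-child (K9) / 3-child (KT) re-split of M, should the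
  planner retire the closed PT child (TARGET R277), and of the Kummer re-key option (R274).

HONEST FRAMING.  Conditional on the named published inputs (modularity, GZK, Kato's member package — cite-level, no `_holds`
expected for the package: Kato's Euler system and explicit reciprocity, size XL).  Item 19196 is NOT closed by this file (its
children 27962 / 28002 / 20296 / 20298 stay HELD); nothing is booked; no summit statement is touched; the Birch–Swinnerton-Dyer
conjecture is NOT proved for any curve by any of this.

References: K. Kato, Astérisque 295 (2004), Thm. 12.5/12.6 (p. 222), Lemma 13.10 (1) (p. 230), Thm. 14.5 (2) (p. 236), (14.9.3)
(p. 240), (14.14.1)–(14.14.2) (p. 243), Prop. 14.16 (2) (pp. 244–245), Lemma 14.18 (pp. 247–248) [Kato2004Asterisque]; C.-H. Kim,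
AJM 148 §3.2.3 [Kim2022StructureSelmer]; J. S. Milne, *ADT* (2006) I Cor. 2.3, Thm. 4.10 (b) [MilneADT2006]; B. Howard, Compos.
Math. 140 (2004) Thm. 2.1.11 [Howard2004HeegnerKolyvagin]; H. Darmon, CBMS 101 Thm. 3.22 [Darmon2004].
-/

set_option autoImplicit false
-- the directory name repeats the summit name (cell layout D-0017)
set_option linter.dupNamespace false

noncomputable section

namespace Summit.BirchSwinnertonDyer.BirchSwinnertonDyer.Theorems.CoreInputsNoPT

open Literature.NumberTheory.EllipticCurves Literature.NumberTheory.EllipticCurves.ModularForms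
  Literature.NumberTheory.EllipticCurves.Kato2004 Literature.NumberTheory.GaloisCohomology
open Summit.BirchSwinnertonDyer.BirchSwinnertonDyer.Theorems

/-! ## §1 Poitou–Tate duality for Selmer structures over `ℚ` — a theorem of the tree -/

/-- **`poitouTate_selmerStructure_duality ℚ` holds** (Milne *ADT* I Thm. 4.10 (b) / Mazur–Rubin Thm. 2.3.4 over `ℚ`): the
conjugation-compatible form `poitouTate_selmerStructure_duality_conj_holds ℚ` followed by the forgetful bridge
`poitouTate_selmerStructure_duality_of_conj`.  Unconditional (the content of the closed item 27963, p641385).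
[cite: MilneADT2006, Ch. I, Thm. 4.10 (b) (proof, p. 58), Cor. 2.3, Thm. 2.6]
[cite: Howard2004HeegnerKolyvagin, Thm. 2.1.11 (arXiv:1202.6340 p. 6)] -/
theorem poitouTate_selmerStructure_duality_rat : poitouTate_selmerStructure_duality ℚ :=
  poitouTate_selmerStructure_duality_of_conj (InputsPoitouTateSelmer.poitouTate_selmerStructure_duality_conj_holds ℚ)

/-! ## §2 Route-free compositions without the Poitou–Tate hypothesis -/

/-- **`exists_memberHullZetaCoreInputs → exists_memberHullZetaInputs` given ONLY Gross–Zagier–Kolyvagin**: the retired gen-3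
held package of M (item 20297) from the core package (item 27962) — seat rkm g21's
`MemberHullZetaInputsOfCore.exists_memberHullZetaInputs_of_coreInputs` (Kato Thm. 14.5 (2) and Prop. 14.16 (2) re-derived from
(b′), (c2′)) with its Poitou–Tate hypothesis discharged by §1.
[cite: Kato2004Asterisque, Thm. 14.5 (2) (p. 236), Prop. 14.16 (2) (pp. 244–245), Lemma 14.18 (pp. 247–248), (14.14.2) (p. 243)]
[cite: MilneADT2006, Ch. I, Thm. 4.10 (b)] [cite: Darmon2004, Thm. 3.22] -/
theorem exists_memberHullZetaInputs_of_gzk_of_coreInputs (hGZK : rank_eq_analyticRank_of_analyticRank_le_one)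
    (h : exists_memberHullZetaCoreInputs) : exists_memberHullZetaInputs :=
  MemberHullZetaInputsOfCore.exists_memberHullZetaInputs_of_coreInputs hGZK poitouTate_selmerStructure_duality_rat h

/-- **`exists_memberHullZetaKummerCoreInputs → exists_memberHullZetaInputs` given ONLY Gross–Zagier–Kolyvagin** (the
print-exact Kummer-form package, p637289, through the kernel bridge Kummer ⇒ pairing form, p638165, then the previous theorem).
[cite: Kato2004Asterisque, Prop. 14.16 (2) (p. 244) and Lemma 14.18 (pp. 247–248)] [cite: MilneADT2006, Ch. I, Cor. 3.4 and Thm. 4.10 (b)] -/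
theorem exists_memberHullZetaInputs_of_gzk_of_kummerCoreInputs (hGZK : rank_eq_analyticRank_of_analyticRank_le_one)
    (h : exists_memberHullZetaKummerCoreInputs) : exists_memberHullZetaInputs :=
  exists_memberHullZetaInputs_of_gzk_of_coreInputs hGZK
    (MemberHullZetaCoreInputsOfKummer.exists_memberHullZetaCoreInputs_of_kummerCoreInputs h)

/-- **The O6 node behind crux M, `Rank1Residual.O6.KatoMemberShaBoundOfReducible`, from modularity, Gross–Zagier–Kolyvagin and
Kato's CORE member package — no Poitou–Tate hypothesis.**  Composition of the previous theorem with seat rkm g13's route-free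
descent `ZetaInputsDescent.katoMemberShaBoundOfReducible_of_newform_of_zetaInputs`.
[cite: Kato2004Asterisque, Thm. 12.5/12.6 (p. 222), Lemma 13.10 (1) (p. 230), (14.14.1)–(14.14.2) (p. 243), Prop. 14.16 (2) (pp. 244–245)]
[cite: Kim2022StructureSelmer, §3.2.3] [cite: Darmon2004, Thm. 3.22] -/
theorem katoMemberShaBoundOfReducible_of_newform_of_gzk_of_coreInputs (hmod : exists_isNewformOf)
    (hGZK : rank_eq_analyticRank_of_analyticRank_le_one) (h : exists_memberHullZetaCoreInputs) :
    Summit.BirchSwinnertonDyer.Rank1Residual.O6.KatoMemberShaBoundOfReducible :=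
  ZetaInputsDescent.katoMemberShaBoundOfReducible_of_newform_of_zetaInputs hmod
    (exists_memberHullZetaInputs_of_gzk_of_coreInputs hGZK h)

/-- **The O6 node behind crux M from modularity, Gross–Zagier–Kolyvagin and the PRINT-EXACT Kummer-form member package — no
Poitou–Tate hypothesis.** [cite: Kato2004Asterisque, Prop. 14.16 (2) (p. 244) and Lemma 14.18 (pp. 247–248)]
[cite: Kim2022StructureSelmer, §3.2.3 and Lemma 3.10] [cite: Darmon2004, Thm. 3.22] -/
theorem katoMemberShaBoundOfReducible_of_newform_of_gzk_of_kummerCoreInputs (hmod : exists_isNewformOf)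
    (hGZK : rank_eq_analyticRank_of_analyticRank_le_one) (h : exists_memberHullZetaKummerCoreInputs) :
    Summit.BirchSwinnertonDyer.Rank1Residual.O6.KatoMemberShaBoundOfReducible :=
  ZetaInputsDescent.katoMemberShaBoundOfReducible_of_newform_of_zetaInputs hmod
    (exists_memberHullZetaInputs_of_gzk_of_kummerCoreInputs hGZK h)

/-! ## §3 Typed closers of crux M over the LIVE route declarations (conclusion = the route decl BY NAME) -/

/-- **K9: crux `ReducibleKatoMember` (item 19196) from the two live HELD children 28002 `PublishedInputsModularityGZK` and 27962
`PublishedInputMemberHullZetaCore` ALONE** (the Poitou–Tate child 27963 is closed and discharged here; the display-only alias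
child 28003 is not needed).  The aliases unfold by `rfl`.  Conditional on the two named published inputs; the item is not closed
by this theorem; BSD is not proved by this.
[cite: Kato2004Asterisque, Thm. 12.6 (p. 222), Prop. 14.16 (2) (pp. 244–245), Lemma 14.18 (pp. 247–248)] [cite: MilneADT2006, Ch. I, Thm. 4.10 (b)] -/
theorem wildReducibleKatoMember_of_modularityGZK_of_coreInputs
    (hMG : Summit.BirchSwinnertonDyer.BirchSwinnertonDyer.Theses.KatoDescentPotSupersingular.PublishedInputsModularityGZK)
    (hC : Summit.BirchSwinnertonDyer.BirchSwinnertonDyer.Theses.KatoDescentPotSupersingular.PublishedInputMemberHullZetaCore) :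
    Summit.BirchSwinnertonDyer.BirchSwinnertonDyer.Theses.KatoDescentPotSupersingular.ReducibleKatoMember :=
  katoMemberShaBoundOfReducible_of_newform_of_gzk_of_coreInputs hMG.1 hMG.2 hC

/-- **K8-t′: crux `ReducibleKatoMember` (item 19196) from the three live HELD children 20296 `PublishedInputNewformKatoZ`, 27962
`PublishedInputMemberHullZetaCore`, 20298 `PublishedInputRankEqAnalyticRankZ` ALONE** (the Poitou–Tate child 27963 is closed and
discharged here).  The aliases unfold by `rfl`.  Conditional on the three named published inputs; the item is not closed by this
theorem; BSD is not proved by this.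
[cite: Kato2004Asterisque, Thm. 12.6 (p. 222), Prop. 14.16 (2) (pp. 244–245), Lemma 14.18 (pp. 247–248)] [cite: MilneADT2006, Ch. I, Thm. 4.10 (b)] -/
theorem tameReducibleKatoMember_of_newformZ_of_coreInputs_of_rankZ
    (hN : Summit.BirchSwinnertonDyer.BirchSwinnertonDyer.Theses.KatoDescentTamePotSupersingular.PublishedInputNewformKatoZ)
    (hC : Summit.BirchSwinnertonDyer.BirchSwinnertonDyer.Theses.KatoDescentTamePotSupersingular.PublishedInputMemberHullZetaCore)
    (hG : Summit.BirchSwinnertonDyer.BirchSwinnertonDyer.Theses.KatoDescentTamePotSupersingular.PublishedInputRankEqAnalyticRankZ) :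
    Summit.BirchSwinnertonDyer.BirchSwinnertonDyer.Theses.KatoDescentTamePotSupersingular.ReducibleKatoMember :=
  katoMemberShaBoundOfReducible_of_newform_of_gzk_of_coreInputs hN hG hC

end Summit.BirchSwinnertonDyer.BirchSwinnertonDyer.Theorems.CoreInputsNoPT

end
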